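import Literature.NumberTheory.Transcendental.QuadraticRelationsLogarithmsSec3Place
import Literature.NumberTheory.Transcendental.QuadraticRelationsLogarithmsSec3Heights
import Literature.NumberTheory.Transcendental.QuadraticRelationsLogarithmsMahlerWeil
import Literature.NumberTheory.Transcendental.QuadraticRelationsLogarithmsThm32C
import Mathlib.FieldTheory.PrimitiveElement
import Mathlib.RingTheory.Localization.Integral
import Mathlib.Analysis.Complex.Polynomial.Basic
import Mathlib.Analysis.Calculus.MeanValue
import Mathlib.Analysis.Calculus.ContDiff.Basic
import Mathlib.Analysis.SpecialFunctions.Pow.Real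
import Mathlib.Topology.Algebra.Polynomial
import HarnessLib

/-!
# Roy–Waldschmidt 1997, Théorème 3.1 (simultaneous algebraic approximation in a field of transcendence degree one)

D. Roy, M. Waldschmidt, *Approximation diophantienne et indépendance algébrique de logarithmes*,
Ann. Sci. ÉNS (4) 30 (1997) 753–796, Théorème 3.1 (p. 763) and its proof "(i) Réduction au cas
d'un seul nombre", pp. 764–765:

> **Théorème 3.1.** Soit `K` un sous-corps de `ℂ` de type fini et de degré de transcendance `1`
> sur `ℚ` et soient `a₁, …, aₙ` des éléments de `K`. Alors, il existe une constante `c > 0` qui ne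
> dépend que de `K` et des nombres `a₁, …, aₙ`, et qui possède la propriété suivante. Soit `κ` un
> nombre réel `≥ c`. Pour une infinité d'entiers `D`, il existe une place `𝔭` de `K` de degré `D` et
> un plongement de son corps résiduel `K̃` dans `ℂ` tels que les nombres `a₁, …, aₙ` appartiennent
> à l'anneau de valuation `𝒪` de `𝔭` et que leurs images `ã₁, …, ãₙ` sous l'homomorphisme de
> réduction `τ : 𝒪 → K̃` associé à `𝔭` vérifient `h₁(ã₁, …, ãₙ) ≤ κ`,
> `max |aᵢ - ãᵢ| ≤ exp(-c⁻¹κD²)`, et aussi `ãᵢ = aᵢ` pour chaque indice `i` avec `aᵢ ∈ ℚ̄`.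

`thm_3_1` proves it (in the exact form consumed by the §5 assembly,
`…Sec5Assembly.lean`) from Théorème 3.2 (`RoyWaldschmidt1997.thm_3_2`, `…Thm32C.lean`).  The
proof follows the paper's reduction to one number with one deviation, announced in
`…Sec3Place.lean`: instead of the analytic local inverse `φ` of a generic linear projection of the
curve of `a = (a₁, …, aₙ)` and Lemme 3.3 (heights under a finite morphism, Serre), we write
`K = ℚ(θ)(β)` with `β` integral over `ℚ[θ]`, `aᵢ = Gᵢ(θ, β)/Qᵢ(θ)` (`exists_fraction_repr`), take
for `ã` the point `(Gᵢ(α, β̃)/Qᵢ(α))ᵢ` where `α` is the approximation of `θ` given by Théorème 3.2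
and `β̃` a root of the specialised minimal polynomial of `β` close to `β` (`approx_step`: the crude
bound `|β̃ - β|^m ≤ |M_α(β)| ≪ |α - θ|` replaces the Lipschitz estimate of `φ`, and costs only a
constant factor in the exponent), obtain the place and the reduction map from `…Sec3Place.lean`
(Chevalley), bound the heights by `h(ã) ≤ C₂ + C₁ h(α)` (`height_step`, elementary height
inequalities in place of Lemme 3.3) and `h(α) = log M(P)/d` (`…MahlerWeil.lean`), and conclude
that `ãᵢ = aᵢ` for algebraic `aᵢ` since Galois conjugates are separated (`exists_separation`,
"l'inégalité de Liouville" of the paper).  All constants are absorbed into `c` exactly as on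
p. 764 ("On pose `c = max{2c₁, …}`").

No definitions, no named facts.

## References

* [RoyWaldschmidt1997ENS] D. Roy, M. Waldschmidt, Ann. Sci. ÉNS (4) 30 (1997) 753–796,
  Théorème 3.1 p. 763, proof pp. 764–765; Théorème 3.2 p. 763.
-/

noncomputable section

open Polynomial IntermediateField Finset Metric Height

namespace Literature.NumberTheory.Transcendental

namespace RoyWaldschmidt1997

open Literature.NumberTheory.DiophantineGeometry
open Literature.NumberTheory.DiophantineGeometry.AlgFunctionField

section analysis

/-- `a ^ card s ≤ ∏ s` if `0 ≤ a ≤ x` for all `x ∈ s`. [folklore] -/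
theorem pow_card_le_multiset_prod (s : Multiset ℝ) {a : ℝ} (ha : 0 ≤ a) (h : ∀ x ∈ s, a ≤ x) :
    a ^ Multiset.card s ≤ s.prod := by
  induction s using Multiset.induction_on with
  | empty => simp
  | cons b s ih =>
    rw [Multiset.card_cons, pow_succ, Multiset.prod_cons, mul_comm]
    have hb : a ≤ b := h b (Multiset.mem_cons_self b s)
    have hs : ∀ x ∈ s, a ≤ x := fun x hx => h x (Multiset.mem_cons_of_mem hx)
    exact mul_le_mul hb (ih hs) (pow_nonneg ha _) (ha.trans hb)

/-- **A monic complex polynomial has a root `r` with `|z - r|^m ≤ |Q(z)|`** (`m = deg Q ≥ 1`).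
[folklore] -/
theorem exists_root_norm_sub_pow_le (Q : ℂ[X]) (hQ : Q.Monic) (hm : 0 < Q.natDegree) (z : ℂ) :
    ∃ r ∈ Q.roots, ‖z - r‖ ^ Q.natDegree ≤ ‖Q.eval z‖ := by
  classical
  have hsplit : Q.roots.card = Q.natDegree := splits_iff_card_roots.mp (IsAlgClosed.splits Q)
  have hprod : (Q.roots.map fun r => X - C r).prod = Q := by
    have h := C_leadingCoeff_mul_prod_multiset_X_sub_C hsplit
    rwa [hQ.leadingCoeff, C_1, one_mul] at h
  have hne : Q.roots.toFinset.Nonempty := by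
    rw [Finset.nonempty_iff_ne_empty, Ne, Multiset.toFinset_eq_empty]
    intro h0
    rw [h0, Multiset.card_zero] at hsplit
    omega
  obtain ⟨r₀, hr₀, hmin⟩ := Finset.exists_min_image Q.roots.toFinset (fun r => ‖z - r‖) hne
  refine ⟨r₀, Multiset.mem_toFinset.mp hr₀, ?_⟩
  have heval : Q.eval z = (Q.roots.map fun r => z - r).prod := by
    conv_lhs => rw [← hprod]
    rw [eval_multiset_prod, Multiset.map_map]
    congr 1
    apply Multiset.map_congr rfl
    intro r _
    simp
  have hnorm : ∀ s : Multiset ℂ, ‖(s.map fun r => z - r).prod‖ = (s.map fun r => ‖z - r‖).prod := by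
    intro s
    induction s using Multiset.induction_on with
    | empty => simp
    | cons a s ih => simp [ih]
  rw [heval, hnorm Q.roots, ← hsplit]
  have hcard : (Q.roots.map fun r => ‖z - r‖).card = Q.roots.card := Multiset.card_map _ _
  rw [← hcard]
  refine pow_card_le_multiset_prod _ (norm_nonneg _) fun x hx => ?_
  obtain ⟨r, hr, rfl⟩ := Multiset.mem_map.mp hx
  exact hmin r (Multiset.mem_toFinset.mpr hr)

/-- **Local Lipschitz estimate for a polynomial expression `∑ c_{ik} xⁱ yᵏ`**:
`|G(x, y) - G(θ, β)| ≤ L (|x - θ| + |y - β|)` for `|x - θ|, |y - β| ≤ 1`. [folklore] -/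
theorem exists_lipschitz_doubleSum (s : Finset (ℕ × ℕ)) (c : ℕ × ℕ → ℂ) (θ β : ℂ) :
    ∃ L : ℝ, 0 ≤ L ∧ ∀ x y : ℂ, ‖x - θ‖ ≤ 1 → ‖y - β‖ ≤ 1 →
      ‖(∑ pr ∈ s, c pr * x ^ pr.1 * y ^ pr.2) - ∑ pr ∈ s, c pr * θ ^ pr.1 * β ^ pr.2‖ ≤
        L * (‖x - θ‖ + ‖y - β‖) := by
  set Φ : ℂ × ℂ → ℂ := fun p => ∑ pr ∈ s, c pr * p.1 ^ pr.1 * p.2 ^ pr.2 with hΦ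
  have hcd : ContDiff ℂ ⊤ Φ := by
    refine ContDiff.sum fun pr _ => ?_
    exact (contDiff_const.mul (contDiff_fst.pow _)).mul (contDiff_snd.pow _)
  have hdiff : Differentiable ℂ Φ := hcd.differentiable (by simp)
  have hcont : Continuous fun p => fderiv ℂ Φ p := hcd.continuous_fderiv (by simp)
  set S : Set (ℂ × ℂ) := closedBall (θ, β) 1 with hS
  obtain ⟨C₀, hC₀⟩ := (isCompact_closedBall (θ, β) 1).exists_bound_of_continuousOn hcont.continuousOn
  refine ⟨max C₀ 0, le_max_right _ _, fun x y hx hy => ?_⟩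
  have hmem : (x, y) ∈ S := by
    rw [hS, mem_closedBall, Prod.dist_eq, max_le_iff, dist_eq_norm, dist_eq_norm]
    exact ⟨hx, hy⟩
  have hmem0 : (θ, β) ∈ S := mem_closedBall_self zero_le_one
  have h := Convex.norm_image_sub_le_of_norm_fderiv_le (f := Φ) (fun p _ => hdiff.differentiableAt)
    (fun p hp => (hC₀ p hp).trans (le_max_left C₀ 0)) (convex_closedBall _ _) hmem0 hmem
  have hdist : ‖((x, y) : ℂ × ℂ) - (θ, β)‖ ≤ ‖x - θ‖ + ‖y - β‖ := by
    rw [Prod.norm_def, Prod.fst_sub, Prod.snd_sub]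
    exact max_le (le_add_of_nonneg_right (norm_nonneg _)) (le_add_of_nonneg_left (norm_nonneg _))
  calc _ = ‖Φ (x, y) - Φ (θ, β)‖ := rfl
    _ ≤ max C₀ 0 * ‖((x, y) : ℂ × ℂ) - (θ, β)‖ := h
    _ ≤ max C₀ 0 * (‖x - θ‖ + ‖y - β‖) := mul_le_mul_of_nonneg_left hdist (le_max_right _ _)

/-- `|x/y - x'/y'| ≤ (|x| |y - y'| + |x - x'| |y|) / (|y| |y'|)`. [folklore] -/
theorem norm_div_sub_div_le {x y x' y' : ℂ} (hy : y ≠ 0) (hy' : y' ≠ 0) :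
    ‖x / y - x' / y'‖ ≤ (‖x‖ * ‖y - y'‖ + ‖x - x'‖ * ‖y‖) / (‖y‖ * ‖y'‖) := by
  have e : x / y - x' / y' = (x * (y' - y) + (x - x') * y) / (y * y') := by
    field_simp; ring
  rw [e, norm_div, norm_mul]
  apply div_le_div_of_nonneg_right _ (by positivity)
  calc ‖x * (y' - y) + (x - x') * y‖ ≤ ‖x * (y' - y)‖ + ‖(x - x') * y‖ := norm_add_le _ _
    _ = ‖x‖ * ‖y - y'‖ + ‖x - x'‖ * ‖y‖ := by rw [norm_mul, norm_mul, norm_sub_rev]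


/-- `Q(x) = ∑ⱼ Qⱼ xʲ y⁰` as a double sum (any `y`). [folklore] -/
theorem aeval_eq_doubleSum {A : Type*} [CommRing A] [Algebra ℚ A] (Q : ℚ[X]) (x y : A) :
    aeval x Q = ∑ pr ∈ range (Q.natDegree + 1) ×ˢ range 1,
      algebraMap ℚ A (Q.coeff pr.1) * x ^ pr.1 * y ^ pr.2 := by
  rw [Finset.sum_product, aeval_eq_sum_range]
  refine Finset.sum_congr rfl fun i _ => ?_
  rw [Finset.sum_range_one, pow_zero, mul_one, Algebra.smul_def]

set_option maxHeartbeats 1600000 in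
/-- **The approximation step of the proof of Théorème 3.1** (p. 765, "‖a - ã‖ ≤ c₂|θ - α|"; here
with the exponent `1/m` coming from the crude root bound `|β - β̃|^m ≤ |M_α(β)|` in place of the
paper's analytic parametrisation): for `α` close to `θ` there is a root `β̃` of the specialised
minimal polynomial `M_α` with `|β̃ - β| ≤ 1`, the denominators `Qᵢ(α)` do not vanish, and
`|Gᵢ(θ,β)/Qᵢ(θ) - Gᵢ(α,β̃)/Qᵢ(α)| ≤ E |α - θ|^{1/m}`.
[cite: RoyWaldschmidt1997ENS, proof of Théorème 3.1, pp. 764–765] -/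
theorem approx_step (θ β : ℂ) (sM : Finset (ℕ × ℕ)) (cM : ℕ × ℕ → ℚ) (Mq : Polynomial ℚ[X])
    (hMq : Mq.Monic) (hm : 0 < Mq.natDegree)
    (hMqsum : ∀ x y : ℂ, Mq.eval₂ (Polynomial.aeval x : ℚ[X] →ₐ[ℚ] ℂ).toRingHom y =
      ∑ pr ∈ sM, ((cM pr : ℚ) : ℂ) * x ^ pr.1 * y ^ pr.2)
    (hMθβ : ∑ pr ∈ sM, ((cM pr : ℚ) : ℂ) * θ ^ pr.1 * β ^ pr.2 = 0)
    {ι : Type} [Fintype ι] (s : ι → Finset (ℕ × ℕ)) (c : ι → ℕ × ℕ → ℚ) (Q : ι → ℚ[X])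
    (hQ : ∀ i, aeval θ (Q i) ≠ 0) :
    ∃ ε₀ : ℝ, 0 < ε₀ ∧ ∃ E : ℝ, 0 ≤ E ∧ ∀ α : ℂ, ‖α - θ‖ ≤ ε₀ →
      ∃ βt : ℂ, Mq.eval₂ (Polynomial.aeval α : ℚ[X] →ₐ[ℚ] ℂ).toRingHom βt = 0 ∧ ‖βt - β‖ ≤ 1 ∧
        (∀ i, aeval α (Q i) ≠ 0) ∧
        ∀ i, ‖(∑ pr ∈ s i, ((c i pr : ℚ) : ℂ) * θ ^ pr.1 * β ^ pr.2) / aeval θ (Q i) -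
              (∑ pr ∈ s i, ((c i pr : ℚ) : ℂ) * α ^ pr.1 * βt ^ pr.2) / aeval α (Q i)‖ ≤
            E * ‖α - θ‖ ^ (1 / (Mq.natDegree : ℝ)) := by
  classical
  -- Lipschitz constants near `(θ, β)`
  obtain ⟨LM, hLM0, hLM⟩ := exists_lipschitz_doubleSum sM (fun pr => ((cM pr : ℚ) : ℂ)) θ β
  have hG := fun i => exists_lipschitz_doubleSum (s i) (fun pr => ((c i pr : ℚ) : ℂ)) θ β
  choose LG hLG0 hLG using hG
  have hQl := fun i => exists_lipschitz_doubleSum (range ((Q i).natDegree + 1) ×ˢ range 1)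
    (fun pr => (((Q i).coeff pr.1 : ℚ) : ℂ)) θ β
  choose LQ hLQ0 hLQ using hQl
  have hQsum : ∀ i (x : ℂ), aeval x (Q i) =
      ∑ pr ∈ range ((Q i).natDegree + 1) ×ˢ range 1, (((Q i).coeff pr.1 : ℚ) : ℂ) * x ^ pr.1 * β ^ pr.2 :=
    fun i x => aeval_eq_doubleSum (Q i) x β
  -- positive constants
  set qn : ι → ℝ := fun i => ‖aeval θ (Q i)‖ with hqn
  have hqn0 : ∀ i, 0 < qn i := fun i => norm_pos_iff.mpr (hQ i)
  set gn : ι → ℝ := fun i => ‖∑ pr ∈ s i, ((c i pr : ℚ) : ℂ) * θ ^ pr.1 * β ^ pr.2‖ with hgn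
  set LM' : ℝ := LM + 1 with hLM'
  have hLM'1 : 1 ≤ LM' := by rw [hLM']; linarith
  set ε₀ : ℝ := 1 / (LM' + ∑ i, 2 * (LQ i + 1) / qn i) with hε₀
  have hden_pos : 0 < LM' + ∑ i, 2 * (LQ i + 1) / qn i := by
    have : 0 ≤ ∑ i, 2 * (LQ i + 1) / qn i := sum_nonneg fun i _ => by
      have := hqn0 i; have := hLQ0 i; positivity
    linarith
  have hε₀pos : 0 < ε₀ := by rw [hε₀]; positivity
  have hε₀1 : ε₀ ≤ 1 := by
    rw [hε₀, div_le_one hden_pos]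
    have : 0 ≤ ∑ i, 2 * (LQ i + 1) / qn i := sum_nonneg fun i _ => by
      have := hqn0 i; have := hLQ0 i; positivity
    linarith
  have hε₀LM : LM' * ε₀ ≤ 1 := by
    rw [hε₀, mul_one_div, div_le_one hden_pos]
    have : 0 ≤ ∑ i, 2 * (LQ i + 1) / qn i := sum_nonneg fun i _ => by
      have := hqn0 i; have := hLQ0 i; positivity
    linarith
  have hε₀Q : ∀ i, (LQ i) * ε₀ ≤ qn i / 2 := by
    intro i
    have h1 : 2 * (LQ i + 1) / qn i ≤ LM' + ∑ j, 2 * (LQ j + 1) / qn j := by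
      have h2 : 2 * (LQ i + 1) / qn i ≤ ∑ j, 2 * (LQ j + 1) / qn j :=
        Finset.single_le_sum (f := fun j => 2 * (LQ j + 1) / qn j)
          (fun j _ => by have := hqn0 j; have := hLQ0 j; positivity) (mem_univ i)
      linarith
    -- `LQ ε₀ ≤ LQ / (2 (LQ+1)/qn) = LQ qn / (2(LQ+1)) ≤ qn/2`
    have hq := hqn0 i
    have hL := hLQ0 i
    rw [hε₀]
    rw [mul_one_div, div_le_iff₀ hden_pos]
    have h3 : qn i / 2 * (2 * (LQ i + 1) / qn i) = LQ i + 1 := by field_simp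
    calc LQ i ≤ LQ i + 1 := by linarith
      _ = qn i / 2 * (2 * (LQ i + 1) / qn i) := h3.symm
      _ ≤ qn i / 2 * (LM' + ∑ j, 2 * (LQ j + 1) / qn j) := mul_le_mul_of_nonneg_left h1 (by positivity)
  -- the constant `E`
  set E : ℝ := ∑ i, (gn i * LQ i + 2 * LG i * qn i) / (qn i * (qn i / 2)) * LM' with hE
  have hEi0 : ∀ i, 0 ≤ (gn i * LQ i + 2 * LG i * qn i) / (qn i * (qn i / 2)) * LM' := fun i => by
    have := hqn0 i; have := hLQ0 i; have := hLG0 i; positivity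
  have hE0 : 0 ≤ E := sum_nonneg fun i _ => hEi0 i
  refine ⟨ε₀, hε₀pos, E, hE0, fun α hα => ?_⟩
  set ε : ℝ := ‖α - θ‖ with hε
  have hε0 : 0 ≤ ε := norm_nonneg _
  have hε1 : ε ≤ 1 := hα.trans hε₀1
  -- the root `β̃`
  set Mα : ℂ[X] := Mq.map (Polynomial.aeval α : ℚ[X] →ₐ[ℚ] ℂ).toRingHom with hMα
  have hMαmonic : Mα.Monic := hMq.map _
  have hMαdeg : Mα.natDegree = Mq.natDegree := hMq.natDegree_map _
  obtain ⟨βt, hβtroot, hβtdist⟩ := exists_root_norm_sub_pow_le Mα hMαmonic (by rw [hMαdeg]; exact hm) β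
  have hβteval : Mq.eval₂ (Polynomial.aeval α : ℚ[X] →ₐ[ℚ] ℂ).toRingHom βt = 0 := by
    have h := (mem_roots hMαmonic.ne_zero).mp hβtroot
    rwa [IsRoot, hMα, eval_map] at h
  -- `|β - β̃|^m ≤ LM' ε`
  have hMαβ : ‖Mα.eval β‖ ≤ LM' * ε := by
    rw [hMα, eval_map, hMqsum]
    have h := hLM α β hε1 (by simp)
    rw [hMθβ, sub_zero, sub_self, norm_zero, add_zero] at h
    calc _ ≤ LM * ε := h
      _ ≤ LM' * ε := mul_le_mul_of_nonneg_right (by rw [hLM']; linarith) hε0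
  set η : ℝ := (LM' * ε) ^ (1 / (Mq.natDegree : ℝ)) with hη
  have hmR : (0 : ℝ) < Mq.natDegree := by exact_mod_cast hm
  have hη0 : 0 ≤ η := Real.rpow_nonneg (by positivity) _
  have hβtβ : ‖βt - β‖ ≤ η := by
    rw [norm_sub_rev]
    have h1 : ‖β - βt‖ ^ Mq.natDegree ≤ LM' * ε := by rw [← hMαdeg]; exact hβtdist.trans hMαβ
    have h2 := Real.rpow_le_rpow (pow_nonneg (norm_nonneg _) _) h1 (le_of_lt (one_div_pos.mpr hmR))
    rwa [← Real.rpow_natCast, ← Real.rpow_mul (norm_nonneg _), mul_one_div_cancel hmR.ne',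
      Real.rpow_one] at h2
  have hLMε : LM' * ε ≤ 1 := (mul_le_mul_of_nonneg_left hα (by positivity)).trans hε₀LM
  have hη1 : η ≤ 1 := by
    rw [hη]
    calc (LM' * ε) ^ (1 / (Mq.natDegree : ℝ)) ≤ (1 : ℝ) ^ (1 / (Mq.natDegree : ℝ)) :=
          Real.rpow_le_rpow (by positivity) hLMε (by positivity)
      _ = 1 := Real.one_rpow _
  have hm1 : 1 / (Mq.natDegree : ℝ) ≤ 1 := by
    rw [div_le_one hmR]; exact_mod_cast hm
  have hεη : ε ≤ η := by
    rcases hε0.lt_or_eq with hpos | hzero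
    · calc ε = ε ^ (1 : ℝ) := (Real.rpow_one ε).symm
        _ ≤ ε ^ (1 / (Mq.natDegree : ℝ)) := Real.rpow_le_rpow_of_exponent_ge hpos hε1 hm1
        _ ≤ (LM' * ε) ^ (1 / (Mq.natDegree : ℝ)) :=
            Real.rpow_le_rpow hε0 (le_mul_of_one_le_left hε0 hLM'1) (by positivity)
    · rw [← hzero]; exact hη0
  have hηle : η ≤ LM' * ε ^ (1 / (Mq.natDegree : ℝ)) := by
    rw [hη, Real.mul_rpow (by positivity) hε0]
    refine mul_le_mul_of_nonneg_right ?_ (Real.rpow_nonneg hε0 _)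
    calc LM' ^ (1 / (Mq.natDegree : ℝ)) ≤ LM' ^ (1 : ℝ) := Real.rpow_le_rpow_of_exponent_le hLM'1 hm1
      _ = LM' := Real.rpow_one _
  -- the denominators `Qᵢ(α)`
  have hQα : ∀ i, ‖aeval α (Q i) - aeval θ (Q i)‖ ≤ qn i / 2 := by
    intro i
    rw [hQsum i α, hQsum i θ]
    have h := hLQ i α β hε1 (by simp)
    rw [sub_self, norm_zero, add_zero] at h
    exact h.trans ((mul_le_mul_of_nonneg_left hα (hLQ0 i)).trans (hε₀Q i))
  have hQαn : ∀ i, qn i / 2 ≤ ‖aeval α (Q i)‖ := by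
    intro i
    have h1 := norm_sub_norm_le (aeval θ (Q i)) (aeval α (Q i))
    rw [← norm_sub_rev (aeval α (Q i))] at h1
    have h2 := hQα i
    have h3 : qn i = ‖aeval θ (Q i)‖ := rfl
    linarith
  have hQα0 : ∀ i, aeval α (Q i) ≠ 0 := fun i h0 => by
    have h1 := hQαn i; rw [h0, norm_zero] at h1; have := hqn0 i; linarith
  -- the numerators `Gᵢ(α, β̃)`
  have hGα : ∀ i, ‖(∑ pr ∈ s i, ((c i pr : ℚ) : ℂ) * α ^ pr.1 * βt ^ pr.2) -
      ∑ pr ∈ s i, ((c i pr : ℚ) : ℂ) * θ ^ pr.1 * β ^ pr.2‖ ≤ LG i * (ε + η) := fun i =>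
    (hLG i α βt hε1 (hβtβ.trans hη1)).trans (mul_le_mul_of_nonneg_left (by linarith [hβtβ]) (hLG0 i))
  refine ⟨βt, hβteval, hβtβ.trans hη1, hQα0, fun i => ?_⟩
  have hq := norm_div_sub_div_le (x := ∑ pr ∈ s i, ((c i pr : ℚ) : ℂ) * θ ^ pr.1 * β ^ pr.2)
    (y := aeval θ (Q i)) (x' := ∑ pr ∈ s i, ((c i pr : ℚ) : ℂ) * α ^ pr.1 * βt ^ pr.2)
    (y' := aeval α (Q i)) (hQ i) (hQα0 i)
  refine hq.trans ?_
  have hqi := hqn0 i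
  have hLGi := hLG0 i
  have hLQi := hLQ0 i
  have hgn0 : 0 ≤ gn i := norm_nonneg _
  have hnum : ‖∑ pr ∈ s i, ((c i pr : ℚ) : ℂ) * θ ^ pr.1 * β ^ pr.2‖ * ‖aeval θ (Q i) - aeval α (Q i)‖ +
      ‖(∑ pr ∈ s i, ((c i pr : ℚ) : ℂ) * θ ^ pr.1 * β ^ pr.2) -
        ∑ pr ∈ s i, ((c i pr : ℚ) : ℂ) * α ^ pr.1 * βt ^ pr.2‖ * ‖aeval θ (Q i)‖ ≤
      (gn i * LQ i + 2 * LG i * qn i) * η := by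
    have h1 : ‖aeval θ (Q i) - aeval α (Q i)‖ ≤ LQ i * ε := by
      rw [norm_sub_rev, hQsum i α, hQsum i θ]
      have h := hLQ i α β hε1 (by simp)
      rw [sub_self, norm_zero, add_zero] at h
      exact h
    have h2 : ‖(∑ pr ∈ s i, ((c i pr : ℚ) : ℂ) * θ ^ pr.1 * β ^ pr.2) -
        ∑ pr ∈ s i, ((c i pr : ℚ) : ℂ) * α ^ pr.1 * βt ^ pr.2‖ ≤ LG i * (ε + η) := by
      rw [norm_sub_rev]; exact hGα i
    have h3 : gn i * (LQ i * ε) + LG i * (ε + η) * qn i ≤ (gn i * LQ i + 2 * LG i * qn i) * η := by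
      have h4 : gn i * LQ i * ε ≤ gn i * LQ i * η := mul_le_mul_of_nonneg_left hεη (by positivity)
      have h5 : LG i * qn i * ε ≤ LG i * qn i * η := mul_le_mul_of_nonneg_left hεη (by positivity)
      have e1 : gn i * (LQ i * ε) + LG i * (ε + η) * qn i = gn i * LQ i * ε + LG i * qn i * ε + LG i * qn i * η := by ring
      have e2 : (gn i * LQ i + 2 * LG i * qn i) * η = gn i * LQ i * η + LG i * qn i * η + LG i * qn i * η := by ring
      rw [e1, e2]
      linarith
    calc _ ≤ gn i * (LQ i * ε) + LG i * (ε + η) * qn i := by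
          apply add_le_add
          · exact mul_le_mul_of_nonneg_left h1 hgn0
          · exact mul_le_mul_of_nonneg_right h2 (norm_nonneg _)
      _ ≤ _ := h3
  have hdenom : qn i * (qn i / 2) ≤ ‖aeval θ (Q i)‖ * ‖aeval α (Q i)‖ :=
    mul_le_mul_of_nonneg_left (hQαn i) (norm_nonneg _)
  have hEi : (gn i * LQ i + 2 * LG i * qn i) / (qn i * (qn i / 2)) * LM' ≤ E := by
    rw [hE]
    exact Finset.single_le_sum (f := fun j => (gn j * LQ j + 2 * LG j * qn j) / (qn j * (qn j / 2)) * LM')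
      (fun j _ => hEi0 j) (mem_univ i)
  calc _ ≤ (gn i * LQ i + 2 * LG i * qn i) * η / (qn i * (qn i / 2)) :=
        div_le_div₀ (by positivity) hnum (by positivity) hdenom
    _ = (gn i * LQ i + 2 * LG i * qn i) / (qn i * (qn i / 2)) * η := by ring
    _ ≤ (gn i * LQ i + 2 * LG i * qn i) / (qn i * (qn i / 2)) * (LM' * ε ^ (1 / (Mq.natDegree : ℝ))) :=
        mul_le_mul_of_nonneg_left hηle (by positivity)
    _ = (gn i * LQ i + 2 * LG i * qn i) / (qn i * (qn i / 2)) * LM' * ε ^ (1 / (Mq.natDegree : ℝ)) := by ring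
    _ ≤ E * ε ^ (1 / (Mq.natDegree : ℝ)) := mul_le_mul_of_nonneg_right hEi (Real.rpow_nonneg hε0 _)

end analysis

variable {K : IntermediateField ℚ ℂ}

/-! ### Reduction maps on rational constants and on polynomial expressions -/

/-- A ring homomorphism `τ : 𝒪_𝔭 → ℂ` fixes the rational constants. [folklore] -/
theorem Place.hom_ratCast (p : Place K) (τ : p.ring →+* ℂ) (q : ℚ) :
    τ ⟨(q : K), p.ratCast_mem_ring q⟩ = q := by
  have hden : (q.den : ℂ) ≠ 0 := by exact_mod_cast q.den_ne_zero
  have h1 : (⟨(q : K), p.ratCast_mem_ring q⟩ : p.ring) * (q.den : p.ring) = (q.num : p.ring) := by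
    apply Subtype.ext
    push_cast
    have := Rat.mul_den_eq_num q
    exact_mod_cast congrArg (fun r : ℚ => (r : K)) this
  have h2 := congrArg τ h1
  rw [map_mul, map_natCast, map_intCast] at h2
  rw [eq_div_iff hden |>.mpr h2, Rat.cast_def]

/-- **Polynomial expressions `∑ c_{ik} θⁱ βᵏ` (rational coefficients) lie in `𝒪_𝔭` when `θ, β` do,
and a ring homomorphism `τ : 𝒪_𝔭 → ℂ` evaluates them at `(τ θ, τ β)`.** [folklore] -/
theorem Place.hom_doubleSum (p : Place K) (τ : p.ring →+* ℂ) {θ β : K} (hθ : θ ∈ p.ring)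
    (hβ : β ∈ p.ring) (s : Finset (ℕ × ℕ)) (c : ℕ × ℕ → ℚ) :
    ∃ h : (∑ pr ∈ s, ((c pr : ℚ) : K) * θ ^ pr.1 * β ^ pr.2) ∈ p.ring,
      τ ⟨_, h⟩ = ∑ pr ∈ s, ((c pr : ℚ) : ℂ) * (τ ⟨θ, hθ⟩) ^ pr.1 * (τ ⟨β, hβ⟩) ^ pr.2 := by
  have hmem : (∑ pr ∈ s, ((c pr : ℚ) : K) * θ ^ pr.1 * β ^ pr.2) ∈ p.ring :=
    sum_mem fun pr _ => mul_mem (mul_mem (p.ratCast_mem_ring _) (pow_mem hθ _)) (pow_mem hβ _)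
  refine ⟨hmem, ?_⟩
  have e : (⟨_, hmem⟩ : p.ring) =
      ∑ pr ∈ s, (⟨(c pr : K), p.ratCast_mem_ring _⟩ : p.ring) * ⟨θ, hθ⟩ ^ pr.1 * ⟨β, hβ⟩ ^ pr.2 := by
    apply Subtype.ext
    push_cast
    rfl
  rw [e, map_sum]
  refine Finset.sum_congr rfl fun pr _ => ?_
  rw [map_mul, map_mul, map_pow, map_pow, Place.hom_ratCast]

/-- The same polynomial expression evaluated in `K` and viewed in `ℂ`. [folklore] -/
theorem coe_doubleSum (θ β : K) (s : Finset (ℕ × ℕ)) (c : ℕ × ℕ → ℚ) :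
    ((∑ pr ∈ s, ((c pr : ℚ) : K) * θ ^ pr.1 * β ^ pr.2 : K) : ℂ) =
      ∑ pr ∈ s, ((c pr : ℚ) : ℂ) * (θ : ℂ) ^ pr.1 * (β : ℂ) ^ pr.2 := by
  push_cast
  refine Finset.sum_congr rfl fun pr _ => ?_
  congr 2

/-- A bivariate rational polynomial `G ∈ ℚ[X][Y]` evaluated at `(x, y)` in a `ℚ`-algebra is the
double sum `∑ (G_k)_i xⁱ yᵏ` over a box containing its support. [folklore] -/
theorem eval₂_eq_doubleSum {A : Type*} [CommRing A] [Algebra ℚ A] (G : Polynomial ℚ[X]) {DX DY : ℕ}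
    (hX : ∀ k, (G.coeff k).natDegree ≤ DX) (hY : G.natDegree ≤ DY) (x y : A) :
    G.eval₂ (aeval x : ℚ[X] →ₐ[ℚ] A).toRingHom y =
      ∑ pr ∈ range (DX + 1) ×ˢ range (DY + 1),
        algebraMap ℚ A ((G.coeff pr.2).coeff pr.1) * x ^ pr.1 * y ^ pr.2 := by
  rw [eval₂_eq_sum_range' (aeval x : ℚ[X] →ₐ[ℚ] A).toRingHom (Nat.lt_succ_of_le hY), Finset.sum_product_right]
  refine Finset.sum_congr rfl fun k _ => ?_
  rw [AlgHom.toRingHom_eq_coe, AlgHom.coe_toRingHom,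
    aeval_eq_sum_range' (Nat.lt_succ_of_le (hX k)), Finset.sum_mul]
  refine Finset.sum_congr rfl fun i _ => ?_
  rw [Algebra.smul_def]


/-! ### A generator of `K / ℚ(θ)` integral over `ℚ[θ]`, and coordinates of the `aᵢ` -/

open scoped IntermediateField.algebraAdjoinAdjoin in
/-- **A primitive element of `K/ℚ(θ)` integral over `ℚ[θ]`** (primitive element theorem and
clearing denominators). [folklore] -/
theorem exists_integral_generator [IsAlgFunctionField ℚ K] (θ : K) (hθ : Transcendental ℚ θ) :
    ∃ β : K, IsIntegral (Algebra.adjoin ℚ {θ}) β ∧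
      IntermediateField.adjoin (IntermediateField.adjoin ℚ {θ}) {β} = ⊤ := by
  haveI : FiniteDimensional (IntermediateField.adjoin ℚ {θ}) K :=
    IsAlgFunctionField.finiteDimensional_adjoin_simple hθ
  obtain ⟨β₁, hβ₁⟩ := Field.exists_primitive_element (IntermediateField.adjoin ℚ {θ}) K
  have halg : IsAlgebraic (Algebra.adjoin ℚ {θ}) β₁ :=
    (IsFractionRing.isAlgebraic_iff (Algebra.adjoin ℚ {θ}) (IntermediateField.adjoin ℚ {θ}) K).mpr
      (Algebra.IsAlgebraic.isAlgebraic β₁)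
  obtain ⟨y, hy0, hint⟩ := halg.exists_integral_multiple
  refine ⟨y • β₁, hint, ?_⟩
  have hyK : ((y : K)) ≠ 0 := fun h => hy0 (Subtype.ext h)
  have hyF : (y : K) ∈ IntermediateField.adjoin ℚ {θ} := IntermediateField.algebra_adjoin_le_adjoin ℚ {θ} y.2
  have hsmul : y • β₁ = (y : K) * β₁ := Algebra.smul_def y β₁
  apply le_antisymm le_top
  rw [← hβ₁]
  refine IntermediateField.adjoin_le_iff.mpr (Set.singleton_subset_iff.mpr ?_)
  have h1 : (y : K) * β₁ ∈ IntermediateField.adjoin (IntermediateField.adjoin ℚ {θ}) {y • β₁} := by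
    rw [← hsmul]; exact IntermediateField.mem_adjoin_simple_self _ _
  have h2 : ((⟨(y : K), hyF⟩ : IntermediateField.adjoin ℚ {θ}) : K) ∈
      IntermediateField.adjoin (IntermediateField.adjoin ℚ {θ}) {y • β₁} :=
    IntermediateField.algebraMap_mem (IntermediateField.adjoin (IntermediateField.adjoin ℚ {θ}) {y • β₁})
      (⟨(y : K), hyF⟩ : IntermediateField.adjoin ℚ {θ})
  have h3 : β₁ = ((y : K))⁻¹ * ((y : K) * β₁) := by field_simp
  have h4 : ((y : K))⁻¹ * ((y : K) * β₁) ∈ IntermediateField.adjoin (IntermediateField.adjoin ℚ {θ}) {y • β₁} :=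
    mul_mem (inv_mem h2) h1
  rw [← h3] at h4
  exact h4

open scoped IntermediateField.algebraAdjoinAdjoin in
/-- **Coordinates**: every `a ∈ K = ℚ(θ)(β)` satisfies `a · Q(θ) = ∑ c_{ik} θⁱ βᵏ` for some
`Q ∈ ℚ[X]` with `Q(θ) ≠ 0` and rational coefficients `c_{ik}` (write `a = ∑ₖ cₖ βᵏ` with
`cₖ ∈ ℚ(θ)` and clear the denominators of the rational functions `cₖ`). [folklore] -/
theorem exists_fraction_repr [IsAlgFunctionField ℚ K] (θ : K) (β : K)
    (hβ : IsIntegral (Algebra.adjoin ℚ {θ}) β)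
    (htop : IntermediateField.adjoin (IntermediateField.adjoin ℚ {θ}) {β} = ⊤) (a : K) :
    ∃ (s : Finset (ℕ × ℕ)) (c : ℕ × ℕ → ℚ) (Q : ℚ[X]), aeval θ Q ≠ 0 ∧
      a * aeval θ Q = ∑ pr ∈ s, ((c pr : ℚ) : K) * θ ^ pr.1 * β ^ pr.2 := by
  classical
  set F₀ := IntermediateField.adjoin ℚ {θ} with hF₀
  have hβalg : IsAlgebraic F₀ β :=
    (IsFractionRing.isAlgebraic_iff (Algebra.adjoin ℚ {θ}) F₀ K).mp hβ.isAlgebraic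
  -- `a = g(β)` with `g ∈ ℚ(θ)[X]`
  have ha : a ∈ Algebra.adjoin F₀ {β} := by
    rw [← IntermediateField.adjoin_simple_toSubalgebra_of_isAlgebraic hβalg, htop]
    exact Algebra.mem_top
  rw [Algebra.adjoin_singleton_eq_range_aeval] at ha
  obtain ⟨g, rfl⟩ := ha
  -- the coefficients as rational functions of `θ`
  have hcoef0 : ∀ k, ∃ r s : ℚ[X], ((g.coeff k : F₀) : K) = aeval θ r / aeval θ s := fun k =>
    (IntermediateField.mem_adjoin_simple_iff (F := ℚ) (α := θ) ((g.coeff k : F₀) : K)).mp (g.coeff k).2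
  choose num den₀ hnumden using hcoef0
  -- make the denominators nonzero at `θ` (a zero denominator means the coefficient is `0`)
  set den : ℕ → ℚ[X] := fun k => if aeval θ (den₀ k) = 0 then 1 else den₀ k with hden
  have hcoef : ∀ k, ((g.coeff k : F₀) : K) = aeval θ (num k) / aeval θ (den k) ∨
      (((g.coeff k : F₀) : K) = 0 ∧ aeval θ (den k) = 1) := by
    intro k
    by_cases h0 : aeval θ (den₀ k) = 0
    · right
      refine ⟨?_, by rw [hden]; simp [h0]⟩
      rw [hnumden k, h0, div_zero]
    · left
      rw [hden]; simp only [h0, ↓reduceIte]; exact hnumden k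
  have hden0 : ∀ k, aeval θ (den k) ≠ 0 := by
    intro k
    rw [hden]
    by_cases h0 : aeval θ (den₀ k) = 0
    · simp [h0]
    · simp [h0]
  set N : ℕ := g.natDegree + 1 with hN
  set Q : ℚ[X] := ∏ k ∈ range N, den k with hQ
  have hQ0 : aeval θ Q ≠ 0 := by
    rw [hQ, map_prod]; exact prod_ne_zero_iff.mpr fun k _ => hden0 k
  set num' : ℕ → ℚ[X] := fun k => if ((g.coeff k : F₀) : K) = 0 then 0 else num k with hnum'
  set R : ℕ → ℚ[X] := fun k => num' k * ∏ j ∈ (range N).erase k, den j with hR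
  have hk : ∀ k ∈ range N, ((g.coeff k : F₀) : K) * aeval θ Q = aeval θ (R k) := by
    intro k hk
    rw [hR]
    simp only [map_mul, map_prod]
    rw [hQ, map_prod, ← mul_prod_erase (range N) (fun j => aeval θ (den j)) hk]
    by_cases hc0 : ((g.coeff k : F₀) : K) = 0
    · rw [hc0, hnum']; simp [hc0]
    · rcases hcoef k with h | h
      · rw [hnum']; simp only [hc0, ↓reduceIte]
        rw [h]
        have hd := hden0 k
        field_simp
      · exact absurd h.1 hc0
  -- `a · Q(θ) = ∑ₖ R_k(θ) βᵏ`
  have hexp : ((aeval β : F₀[X] →ₐ[F₀] K).toRingHom g) * aeval θ Q =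
      ∑ k ∈ range N, aeval θ (R k) * β ^ k := by
    rw [AlgHom.toRingHom_eq_coe, AlgHom.coe_toRingHom, aeval_eq_sum_range, Finset.sum_mul]
    refine Finset.sum_congr rfl fun k hk' => ?_
    rw [← hk k hk', Algebra.smul_def]
    show ((g.coeff k : F₀) : K) * β ^ k * aeval θ Q = ((g.coeff k : F₀) : K) * aeval θ Q * β ^ k
    ring
  -- as a double sum
  set DX : ℕ := (range N).sup fun k => (R k).natDegree with hDX
  have hRdeg : ∀ k ∈ range N, (R k).natDegree ≤ DX := fun k hk => Finset.le_sup (f := fun k => (R k).natDegree) hk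
  refine ⟨range (DX + 1) ×ˢ range N, fun pr => (R pr.2).coeff pr.1, Q, hQ0, ?_⟩
  rw [hexp, Finset.sum_product_right]
  refine Finset.sum_congr rfl fun k hk' => ?_
  rw [aeval_eq_sum_range' (Nat.lt_succ_of_le (hRdeg k hk')), Finset.sum_mul]
  refine Finset.sum_congr rfl fun i _ => ?_
  rw [Algebra.smul_def]
  rfl

section heights

/-! ### Heights of rational polynomial expressions -/

/-- Clearing a common denominator: `q.num · (N / q.den) = q · N` when `q.den ∣ N`. [folklore] -/
theorem Rat.cast_num_mul_div_den (q : ℚ) {N : ℕ} (hN : q.den ∣ N) :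
    (((q.num * (N / q.den : ℕ) : ℤ)) : ℚ) = q * N := by
  obtain ⟨t, ht⟩ := hN
  rw [ht, Nat.mul_div_cancel_left _ q.den_pos]
  push_cast
  have h := Rat.mul_den_eq_num q
  calc (q.num : ℚ) * t = (q * q.den) * t := by rw [h]
    _ = q * ((q.den : ℚ) * t) := by ring

/-- **`h(∑ c_{ik} xⁱ yᵏ) ≤ [F:ℚ] C + D₁ h(x) + D₂ h(y)`** for rational coefficients `c_{ik}`
(`D₁, D₂` bounding the exponents), with `C = C(c) ≥ 0` independent of the number field `F`.
[cite: NesterenkoPhilippon2001, Ch. 2, Lemma 2.10] -/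
theorem exists_logHeight₁_doubleSum_le (s : Finset (ℕ × ℕ)) (c : ℕ × ℕ → ℚ) {D₁ D₂ : ℕ}
    (hD : ∀ p ∈ s, p.1 ≤ D₁ ∧ p.2 ≤ D₂) :
    ∃ C : ℝ, 0 ≤ C ∧ ∀ (F : Type) [Field F] [NumberField F] (x y : F),
      logHeight₁ (∑ pr ∈ s, (c pr : F) * x ^ pr.1 * y ^ pr.2) ≤
        Module.finrank ℚ F * C + D₁ * logHeight₁ x + D₂ * logHeight₁ y := by
  classical
  -- a common denominator
  set N : ℕ := ∏ pr ∈ s, (c pr).den with hNdef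
  have hNpos : 0 < N := prod_pos fun pr _ => (c pr).den_pos
  have hden : ∀ pr ∈ s, (c pr).den ∣ N := fun pr hpr => dvd_prod_of_mem _ hpr
  set a : ℕ × ℕ → ℤ := fun pr => (c pr).num * (N / (c pr).den : ℕ) with hadef
  have ha : ∀ pr ∈ s, ((a pr : ℤ) : ℚ) = c pr * N := fun pr hpr => Rat.cast_num_mul_div_den (c pr) (hden pr hpr)
  set L : ℝ := max 1 (∑ pr ∈ s, |(a pr : ℝ)|) with hLdef
  refine ⟨Real.log N + Real.log L, add_nonneg (Real.log_nonneg (by exact_mod_cast hNpos))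
    (Real.log_nonneg (le_max_left _ _)), ?_⟩
  intro F _ _ x y
  have hNF : (N : F) ≠ 0 := by exact_mod_cast hNpos.ne'
  have hsum : (∑ pr ∈ s, (c pr : F) * x ^ pr.1 * y ^ pr.2) =
      (N : F)⁻¹ * ∑ pr ∈ s, (a pr : F) * x ^ pr.1 * y ^ pr.2 := by
    rw [Finset.mul_sum]
    refine Finset.sum_congr rfl fun pr hpr => ?_
    have e : ((a pr : ℤ) : F) = (c pr : F) * N := by
      have := congrArg (fun q : ℚ => (q : F)) (ha pr hpr)
      push_cast at this
      exact this
    rw [e]; field_simp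
  rw [hsum]
  have h1 := logHeight₁_mul_le (N : F)⁻¹ (∑ pr ∈ s, (a pr : F) * x ^ pr.1 * y ^ pr.2)
  rw [logHeight₁_inv] at h1
  have h2 := logHeight₁_sum_mul_pow_mul_pow_le (F := F) a x y hD
  have h3 : logHeight₁ (N : F) ≤ Module.finrank ℚ F * Real.log N := by
    have h := mulHeight₁_natCast_le (K := F) N hNpos.ne'
    have hlog := Real.log_le_log (mulHeight₁_pos _) h
    rw [Real.log_pow, NumberField.totalWeight_eq_finrank] at hlog
    exact hlog
  rw [NumberField.totalWeight_eq_finrank] at h2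
  have h4 : (Module.finrank ℚ F : ℝ) * (Real.log N + Real.log L) =
      Module.finrank ℚ F * Real.log N + Module.finrank ℚ F * Real.log L := by ring
  rw [h4]
  linarith

/-- The univariate case: `h(Q(x)) ≤ [F:ℚ] C + deg Q · h(x)` for `Q ∈ ℚ[X]`. [folklore] -/
theorem exists_logHeight₁_aeval_le (Q : ℚ[X]) :
    ∃ C : ℝ, 0 ≤ C ∧ ∀ (F : Type) [Field F] [NumberField F] (x : F),
      logHeight₁ (aeval x Q) ≤ Module.finrank ℚ F * C + Q.natDegree * logHeight₁ x := by
  classical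
  obtain ⟨C, hC0, hC⟩ := exists_logHeight₁_doubleSum_le (range (Q.natDegree + 1) ×ˢ range 1)
    (fun pr => Q.coeff pr.1) (D₁ := Q.natDegree) (D₂ := 0) (fun p hp => by
      simp only [mem_product, mem_range] at hp; omega)
  refine ⟨C, hC0, fun F _ _ x => ?_⟩
  have h := hC F x 1
  have e : (∑ pr ∈ range (Q.natDegree + 1) ×ˢ range 1, ((Q.coeff pr.1 : ℚ) : F) * x ^ pr.1 * (1 : F) ^ pr.2) =
      aeval x Q := by
    rw [Finset.sum_product, aeval_eq_sum_range]
    refine Finset.sum_congr rfl fun i _ => ?_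
    rw [Finset.sum_range_one, pow_zero, mul_one, Algebra.smul_def]
    rfl
  rw [e] at h
  simpa using h

/-- **Height of a root of the specialised minimal polynomial**: if
`∑_{i ≤ DX, k ≤ m} c_{ik} xⁱ yᵏ = 0` with `c_{0m} = 1`, `c_{im} = 0` (`i > 0`), i.e. `y` is a root of
a monic polynomial of degree `m` whose coefficients are polynomials of degree `≤ DX` in `x`, then
`h(y) ≤ [F:ℚ] C + m · DX · h(x)` with `C` independent of `F`.
[cite: NesterenkoPhilippon2001, Ch. 2, Lemma 2.8] -/
theorem exists_logHeight₁_root_le {DX m : ℕ} (hm : 0 < m) (c : ℕ × ℕ → ℚ) (hc0 : c (0, m) = 1)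
    (hc : ∀ i, 0 < i → c (i, m) = 0) :
    ∃ C : ℝ, 0 ≤ C ∧ ∀ (F : Type) [Field F] [NumberField F] (x y : F),
      (∑ pr ∈ range (DX + 1) ×ˢ range (m + 1), (c pr : F) * x ^ pr.1 * y ^ pr.2) = 0 →
      logHeight₁ y ≤ Module.finrank ℚ F * C + (m * DX) * logHeight₁ x := by
  classical
  -- constants for the coefficients `b_k(x) = ∑ᵢ c_{ik} xⁱ`
  have hk : ∀ k : ℕ, ∃ C : ℝ, 0 ≤ C ∧ ∀ (F : Type) [Field F] [NumberField F] (x : F),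
      logHeight₁ (∑ i ∈ range (DX + 1), (c (i, k) : F) * x ^ i) ≤ Module.finrank ℚ F * C + DX * logHeight₁ x := by
    intro k
    obtain ⟨C, hC0, hC⟩ := exists_logHeight₁_doubleSum_le (range (DX + 1) ×ˢ range 1) (fun pr => c (pr.1, k))
      (D₁ := DX) (D₂ := 0) (fun p hp => by simp only [mem_product, mem_range] at hp; omega)
    refine ⟨C, hC0, fun F _ _ x => ?_⟩
    have h := hC F x 1
    have e : (∑ pr ∈ range (DX + 1) ×ˢ range 1, ((c (pr.1, k) : ℚ) : F) * x ^ pr.1 * (1 : F) ^ pr.2) =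
        ∑ i ∈ range (DX + 1), (c (i, k) : F) * x ^ i := by
      rw [Finset.sum_product]
      refine Finset.sum_congr rfl fun i _ => ?_
      rw [Finset.sum_range_one, pow_zero, mul_one]
    rw [e] at h
    simpa using h
  choose Ck hCk0 hCk using hk
  refine ⟨Real.log m + ∑ k ∈ range m, Ck k, add_nonneg (Real.log_nonneg (by exact_mod_cast hm)) (sum_nonneg fun k _ => hCk0 k), ?_⟩
  intro F _ _ x y hrel
  set b : ℕ → F := fun k => ∑ i ∈ range (DX + 1), (c (i, k) : F) * x ^ i with hb
  -- the monic relation `y^m + ∑_{k<m} b_k y^k = 0`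
  have hlead : (∑ i ∈ range (DX + 1), (c (i, m) : F) * x ^ i) = 1 := by
    rw [Finset.sum_eq_single 0]
    · rw [hc0]; simp
    · intro i _ hi
      rw [hc i (Nat.pos_of_ne_zero hi)]; simp
    · intro h; exact absurd (mem_range.mpr (Nat.succ_pos _)) h
  have hrel' : y ^ m + ∑ k ∈ range m, b k * y ^ k = 0 := by
    have e : (∑ pr ∈ range (DX + 1) ×ˢ range (m + 1), (c pr : F) * x ^ pr.1 * y ^ pr.2) =
        ∑ k ∈ range (m + 1), b k * y ^ k := by
      rw [Finset.sum_product_right]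
      refine Finset.sum_congr rfl fun k _ => ?_
      rw [hb, Finset.sum_mul]
    rw [e, Finset.sum_range_succ, hb] at hrel
    simp only at hrel
    rw [hlead, one_mul, add_comm] at hrel
    exact hrel
  have hroot := logHeight₁_root_le_of_monic (F := F) hm b hrel'
  rw [NumberField.totalWeight_eq_finrank] at hroot
  have hbk : ∀ k ∈ range m, logHeight₁ (b k) ≤ Module.finrank ℚ F * Ck k + DX * logHeight₁ x :=
    fun k _ => hCk k F x
  have hsumle := Finset.sum_le_sum hbk
  rw [Finset.sum_add_distrib, ← Finset.mul_sum, Finset.sum_const, card_range, nsmul_eq_mul] at hsumle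
  have e4 : (Module.finrank ℚ F : ℝ) * (Real.log m + ∑ k ∈ range m, Ck k) =
      Module.finrank ℚ F * Real.log m + Module.finrank ℚ F * ∑ k ∈ range m, Ck k := by ring
  rw [e4]
  have hcast : (m : ℝ) * DX * logHeight₁ x = (m : ℝ) * (DX * logHeight₁ x) := by ring
  rw [hcast]
  linarith [hroot, hsumle]


/-- **The height step of the proof of Théorème 3.1**: the heights of the reduced coordinates
`ãᵢ = Gᵢ(x, y)/Qᵢ(x)` (`x = α`, `y = β̃` a root of the specialised monic minimal polynomial) are
bounded by `[F:ℚ] C₂ + C₁ h(x)` with constants independent of the number field `F`.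
[cite: RoyWaldschmidt1997ENS, proof of Théorème 3.1, p. 765] -/
theorem height_step {ι : Type} [Fintype ι] (s : ι → Finset (ℕ × ℕ)) (c : ι → ℕ × ℕ → ℚ)
    (Q : ι → ℚ[X]) {DX m : ℕ} (hm : 0 < m) (cM : ℕ × ℕ → ℚ) (hc0 : cM (0, m) = 1)
    (hc : ∀ i, 0 < i → cM (i, m) = 0) :
    ∃ C₁ C₂ : ℝ, 0 ≤ C₁ ∧ 0 ≤ C₂ ∧ ∀ (F : Type) [Field F] [NumberField F] (x y : F),
      (∑ pr ∈ range (DX + 1) ×ˢ range (m + 1), (cM pr : F) * x ^ pr.1 * y ^ pr.2) = 0 →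
      ∑ i, logHeight₁ ((∑ pr ∈ s i, (c i pr : F) * x ^ pr.1 * y ^ pr.2) / aeval x (Q i)) ≤
        Module.finrank ℚ F * C₂ + C₁ * logHeight₁ x := by
  classical
  set D₁ : ι → ℕ := fun i => (s i).sup Prod.fst with hD₁
  set D₂ : ι → ℕ := fun i => (s i).sup Prod.snd with hD₂
  have hG := fun i => exists_logHeight₁_doubleSum_le (s i) (c i) (D₁ := D₁ i)
    (D₂ := D₂ i) (fun p hp => ⟨Finset.le_sup (f := Prod.fst) hp, Finset.le_sup (f := Prod.snd) hp⟩)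
  choose CG hCG0 hCG using hG
  have hQ := fun i => exists_logHeight₁_aeval_le (Q i)
  choose CQ hCQ0 hCQ using hQ
  obtain ⟨CM, hCM0, hCM⟩ := exists_logHeight₁_root_le (DX := DX) hm cM hc0 hc
  set C₁ : ℝ := ∑ i, ((D₁ i : ℝ) + (Q i).natDegree + (D₂ i : ℝ) * (m * DX)) with hC₁
  set C₂ : ℝ := ∑ i, (CG i + CQ i + (D₂ i : ℝ) * CM) with hC₂
  refine ⟨C₁, C₂, sum_nonneg fun i _ => by positivity, sum_nonneg fun i _ => by
    have := hCG0 i; have := hCQ0 i; positivity, ?_⟩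
  intro F _ _ x y hrel
  have hy := hCM F x y hrel
  have hx0 : 0 ≤ logHeight₁ x := zero_le_logHeight₁ x
  have hD : (0 : ℝ) ≤ Module.finrank ℚ F := Nat.cast_nonneg _
  have hi : ∀ i, logHeight₁ ((∑ pr ∈ s i, (c i pr : F) * x ^ pr.1 * y ^ pr.2) / aeval x (Q i)) ≤
      Module.finrank ℚ F * (CG i + CQ i + (D₂ i : ℝ) * CM) +
        ((D₁ i : ℝ) + (Q i).natDegree + (D₂ i : ℝ) * (m * DX)) * logHeight₁ x := by
    intro i
    have h1 := logHeight₁_div_le (∑ pr ∈ s i, (c i pr : F) * x ^ pr.1 * y ^ pr.2) (aeval x (Q i))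
    have h2 := hCG i F x y
    have h3 := hCQ i F x
    have hs0 : (0 : ℝ) ≤ (D₂ i : ℝ) := Nat.cast_nonneg _
    have h4 : (D₂ i : ℝ) * logHeight₁ y ≤
        (D₂ i : ℝ) * (Module.finrank ℚ F * CM + (m * DX) * logHeight₁ x) :=
      mul_le_mul_of_nonneg_left hy hs0
    nlinarith [h1, h2, h3, h4, hs0, hD, hx0]
  calc _ ≤ ∑ i, (Module.finrank ℚ F * (CG i + CQ i + (D₂ i : ℝ) * CM) +
        ((D₁ i : ℝ) + (Q i).natDegree + (D₂ i : ℝ) * (m * DX)) * logHeight₁ x) :=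
        Finset.sum_le_sum fun i _ => hi i
    _ = Module.finrank ℚ F * C₂ + C₁ * logHeight₁ x := by
        rw [hC₁, hC₂, Finset.mul_sum, Finset.sum_mul, ← Finset.sum_add_distrib]

end heights

/-! ### The specialised minimal polynomial, separation of conjugates, the degree of `α` -/

/-- **The minimal polynomial of `β` over `ℚ[θ] ≅ ℚ[X]`**, as `M ∈ ℚ[X][Y]`: it is monic of
positive degree in `Y` and vanishes at `(θ, β)` (complex evaluation). [folklore] -/
theorem minpoly_transport (θ : K) (hθ : Transcendental ℚ θ) (β : K) (hβ : IsIntegral (Algebra.adjoin ℚ {θ}) β)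
    (Mq : Polynomial ℚ[X])
    (hMq : Mq = (minpoly (Algebra.adjoin ℚ {θ}) β).map
      (Polynomial.algEquivOfTranscendental ℚ θ hθ).symm.toAlgHom.toRingHom) :
    Mq.Monic ∧ 0 < Mq.natDegree ∧
      Mq.eval₂ (Polynomial.aeval (θ : ℂ) : ℚ[X] →ₐ[ℚ] ℂ).toRingHom (β : ℂ) = 0 := by
  have hmonic : (minpoly (Algebra.adjoin ℚ {θ}) β).Monic := minpoly.monic hβ
  refine ⟨by rw [hMq]; exact hmonic.map _, by rw [hMq, hmonic.natDegree_map]; exact minpoly.natDegree_pos hβ, ?_⟩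
  rw [hMq, eval₂_map]
  -- the composite `ℚ[θ] ≅ ℚ[X] → ℂ` is the inclusion `ℚ[θ] ⊆ K ⊆ ℂ`
  have hcomp : ((Polynomial.aeval (θ : ℂ) : ℚ[X] →ₐ[ℚ] ℂ).toRingHom.comp
      (Polynomial.algEquivOfTranscendental ℚ θ hθ).symm.toAlgHom.toRingHom) =
      (algebraMap K ℂ).comp (algebraMap (Algebra.adjoin ℚ {θ}) K) := by
    apply RingHom.ext
    intro r
    obtain ⟨g, rfl⟩ := (Polynomial.algEquivOfTranscendental ℚ θ hθ).surjective r
    have h1 : (Polynomial.algEquivOfTranscendental ℚ θ hθ).symm.toAlgHom.toRingHom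
        (Polynomial.algEquivOfTranscendental ℚ θ hθ g) = g :=
      (Polynomial.algEquivOfTranscendental ℚ θ hθ).symm_apply_apply g
    rw [RingHom.comp_apply, RingHom.comp_apply, h1, Polynomial.algEquivOfTranscendental_apply]
    show aeval (algebraMap K ℂ θ) g = algebraMap K ℂ ((aeval (⟨θ, Algebra.self_mem_adjoin_singleton ℚ θ⟩ :
      Algebra.adjoin ℚ {θ}) g : Algebra.adjoin ℚ {θ}) : K)
    rw [Polynomial.aeval_algebraMap_apply, Polynomial.aeval_subalgebra_coe]
  rw [hcomp]
  have h2 : (β : ℂ) = algebraMap K ℂ β := rfl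
  rw [h2, ← Polynomial.hom_eval₂, ← aeval_def, minpoly.aeval, map_zero]

/-- **Separation of conjugates** ("l'inégalité de Liouville donne `ãᵢ = aᵢ`", p. 765): the other
roots of the minimal polynomial of an algebraic `x ∈ ℂ` stay at distance `≥ δ(x) > 0` from `x`.
[cite: RoyWaldschmidt1997ENS, proof of Théorème 3.1, p. 765] -/
theorem exists_separation (x : ℂ) : ∃ δ : ℝ, 0 < δ ∧ (IsAlgebraic ℚ x →
    ∀ z : ℂ, aeval z (minpoly ℚ x) = 0 → z ≠ x → δ ≤ ‖z - x‖) := by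
  classical
  by_cases hx : IsAlgebraic ℚ x
  · set R : Finset ℂ := ((minpoly ℚ x).rootSet ℂ).toFinset.erase x with hR
    by_cases hne : R.Nonempty
    · obtain ⟨z₀, hz₀, hmin⟩ := Finset.exists_min_image R (fun z => ‖z - x‖) hne
      have hz₀x : z₀ ≠ x := (Finset.mem_erase.mp hz₀).1
      refine ⟨‖z₀ - x‖, norm_pos_iff.mpr (sub_ne_zero.mpr hz₀x), fun _ z hz hzx => hmin z ?_⟩
      rw [hR, Finset.mem_erase, Set.mem_toFinset, mem_rootSet]
      exact ⟨hzx, minpoly.ne_zero hx.isIntegral, hz⟩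
    · refine ⟨1, one_pos, fun _ z hz hzx => ?_⟩
      exfalso; apply hne
      refine ⟨z, ?_⟩
      rw [hR, Finset.mem_erase, Set.mem_toFinset, mem_rootSet]
      exact ⟨hzx, minpoly.ne_zero hx.isIntegral, hz⟩
  · exact ⟨1, one_pos, fun h => absurd h hx⟩

/-- A complex root of an irreducible `P ∈ ℤ[X]` of positive degree is integral over `ℚ` and its
minimal polynomial has the degree of `P`. [folklore] -/
theorem natDegree_minpoly_of_irreducible (P : ℤ[X]) (hP : Irreducible P) (hd : 0 < P.natDegree) {α : ℂ}
    (hα : aeval α P = 0) : IsIntegral ℚ α ∧ (minpoly ℚ α).natDegree = P.natDegree := by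
  have hprim : P.IsPrimitive := hP.isPrimitive (by omega)
  set p : ℚ[X] := P.map (Int.castRingHom ℚ) with hp
  have hpirr : Irreducible p := (hprim.irreducible_iff_irreducible_map_fraction_map (K := ℚ)).mp hP
  have hp0 : p ≠ 0 := hpirr.ne_zero
  have haeval : aeval α p = 0 := by rw [hp]; exact (aeval_map_algebraMap ℚ α P).trans hα
  have hmin : minpoly ℚ α = p * C (p.leadingCoeff)⁻¹ := by
    symm
    refine minpoly.eq_of_irreducible_of_monic (irreducible_mul_leadingCoeff_inv.mpr hpirr) ?_
      (monic_mul_leadingCoeff_inv hp0)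
    rw [map_mul, haeval, zero_mul]
  have hint : IsIntegral ℚ α := IsAlgebraic.isIntegral ⟨p, hp0, haeval⟩
  refine ⟨hint, ?_⟩
  rw [hmin, natDegree_mul hp0 (by simp [hp0]), natDegree_C, add_zero, hp,
    natDegree_map_eq_of_injective (Int.castRingHom ℚ).injective_int]

/-- Polynomial expressions commute with the inclusion `K ⊂ ℂ`. [folklore] -/
theorem coe_aeval (θ : K) (g : ℚ[X]) : ((aeval θ g : K) : ℂ) = aeval (θ : ℂ) g :=
  (Polynomial.aeval_algebraMap_apply ℂ θ g).symm

/-! ### Théorème 3.1 -/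

set_option maxHeartbeats 4000000 in
/-- **Roy–Waldschmidt, Théorème 3.1** (simultaneous approximation of elements of a finitely
generated subfield `K ⊂ ℂ` of transcendence degree `1` by the reduction modulo places of large
degree, with heights `≤ κ`, distance `≤ exp(-κD²/c)`, and algebraic coordinates unchanged), in
the form consumed by the §5 assembly. [cite: RoyWaldschmidt1997ENS, Théorème 3.1, p. 763] -/
theorem thm_3_1 (hfg : K.FG) (htr : Algebra.trdeg ℚ K = 1) (ι : Type) [Fintype ι] (a : ι → K) :
    ∃ c : ℝ, 0 < c ∧ ∀ κ : ℝ, c ≤ κ → ∀ D₀ : ℕ, ∃ D : ℕ, D₀ ≤ D ∧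
      ∃ (p : Place K) (τ : p.ring →+* ℂ) (Kt : IntermediateField ℚ ℂ), p.IsReduction τ ∧ p.deg = D ∧
        (∀ x, τ x ∈ Kt) ∧ FiniteDimensional ℚ Kt ∧ Module.finrank ℚ Kt = D ∧
        ∃ ha : ∀ i, a i ∈ p.ring,
          weilHeight₁ Kt (fun i => τ ⟨a i, ha i⟩) ≤ κ ∧
          (∀ i, ‖(a i : ℂ) - τ ⟨a i, ha i⟩‖ ≤ Real.exp (-(κ * (D : ℝ) ^ 2 / c))) ∧
          ∀ i, IsAlgebraic ℚ (a i : ℂ) → τ ⟨a i, ha i⟩ = a i := by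
  classical
  haveI : IsAlgFunctionField ℚ K := isAlgFunctionField_of_fg hfg htr
  /- ## the data: `θ`, `β`, the coordinates of the `aᵢ`, the minimal polynomial of `β` -/
  obtain ⟨θ, hθ⟩ := IsAlgFunctionField.exists_transcendental (K := ℚ) (F := K)
  have hθℂ : Transcendental ℚ (θ : ℂ) := fun h => hθ (IntermediateField.isAlgebraic_iff.mpr h)
  obtain ⟨β, hβint, hβtop⟩ := exists_integral_generator θ hθ
  have hrep := fun i => exists_fraction_repr θ β hβint hβtop (a i)
  choose s c Q hQ0 hrepr using hrep
  obtain ⟨Mq, hMqdef⟩ : ∃ Mq : Polynomial ℚ[X], Mq = (minpoly (Algebra.adjoin ℚ {θ}) β).map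
      (Polynomial.algEquivOfTranscendental ℚ θ hθ).symm.toAlgHom.toRingHom := ⟨_, rfl⟩
  obtain ⟨hMqmonic, hm, hMqθβ⟩ := minpoly_transport θ hθ β hβint Mq hMqdef
  set m : ℕ := Mq.natDegree with hmdef
  set DXM : ℕ := (range (m + 1)).sup fun k => (Mq.coeff k).natDegree with hDXM
  set cM : ℕ × ℕ → ℚ := fun pr => (Mq.coeff pr.2).coeff pr.1 with hcM
  have hMqX : ∀ k, (Mq.coeff k).natDegree ≤ DXM := by
    intro k
    by_cases hk : k ≤ m
    · exact Finset.le_sup (f := fun k => (Mq.coeff k).natDegree) (mem_range.mpr (Nat.lt_succ_of_le hk))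
    · rw [coeff_eq_zero_of_natDegree_lt (lt_of_not_ge hk), natDegree_zero]; exact Nat.zero_le _
  have hMqsum : ∀ (A : Type) [CommRing A] [Algebra ℚ A] (x y : A),
      Mq.eval₂ (Polynomial.aeval x : ℚ[X] →ₐ[ℚ] A).toRingHom y =
        ∑ pr ∈ range (DXM + 1) ×ˢ range (m + 1), algebraMap ℚ A (cM pr) * x ^ pr.1 * y ^ pr.2 :=
    fun A _ _ x y => eval₂_eq_doubleSum Mq hMqX le_rfl x y
  have hc0 : cM (0, m) = 1 := by
    simp only [hcM, hmdef, hMqmonic.coeff_natDegree, coeff_one_zero]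
  have hcpos : ∀ i, 0 < i → cM (i, m) = 0 := by
    intro i hi
    simp only [hcM, hmdef, hMqmonic.coeff_natDegree]
    rw [coeff_one]; simp [hi.ne']
  have hMqsumC : ∀ x y : ℂ, Mq.eval₂ (Polynomial.aeval x : ℚ[X] →ₐ[ℚ] ℂ).toRingHom y =
      ∑ pr ∈ range (DXM + 1) ×ˢ range (m + 1), ((cM pr : ℚ) : ℂ) * x ^ pr.1 * y ^ pr.2 := by
    intro x y
    rw [hMqsum ℂ x y]
    simp only [eq_ratCast]
  have hMθβ' : ∑ pr ∈ range (DXM + 1) ×ˢ range (m + 1), ((cM pr : ℚ) : ℂ) * (θ : ℂ) ^ pr.1 * (β : ℂ) ^ pr.2 = 0 := by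
    rw [← hMqsumC (θ : ℂ) (β : ℂ)]; exact hMqθβ
  /- ## the constants -/
  obtain ⟨ε₀, hε₀, E, hE0, happrox⟩ := approx_step (θ : ℂ) (β : ℂ) (range (DXM + 1) ×ˢ range (m + 1)) cM Mq
    hMqmonic hm hMqsumC hMθβ' s c Q (fun i h0 => hQ0 i (by
      rw [← coe_aeval] at h0
      exact_mod_cast h0))
  obtain ⟨C₁, C₂, hC₁, hC₂, hheight⟩ := height_step s c Q (DX := DXM) hm cM hc0 hcpos
  haveI : FiniteDimensional (IntermediateField.adjoin ℚ {θ}) K :=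
    IsAlgFunctionField.finiteDimensional_adjoin_simple hθ
  set M₀ : ℕ := Module.finrank (IntermediateField.adjoin ℚ {θ}) K with hM₀
  have hM₀pos : 0 < M₀ := Module.finrank_pos
  have hM₀R : (1 : ℝ) ≤ M₀ := by exact_mod_cast hM₀pos
  have hsep := fun i => exists_separation (a i : ℂ)
  choose δ hδ0 hδ using hsep
  -- the constant `c`
  set C₁' : ℝ := C₁ + 1 with hC₁'
  have hC₁'pos : 0 < C₁' := by rw [hC₁']; linarith
  set c₀ : ℝ := max (2 * 10 ^ 7 * (2 * C₁')) (max (2 * C₂ + 2) (max (4 * 10 ^ 7 * m * (M₀ : ℝ) ^ 2 * C₁') 1))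
    with hc₀
  have hc₀1 : 1 ≤ c₀ := le_trans (le_max_right _ _) (le_trans (le_max_right _ _) (le_max_right _ _))
  have hc₀pos : 0 < c₀ := lt_of_lt_of_le one_pos hc₀1
  have hc₀κ : 2 * 10 ^ 7 * (2 * C₁') ≤ c₀ := le_max_left _ _
  have hc₀C₂ : 2 * C₂ + 2 ≤ c₀ := le_trans (le_max_left _ _) (le_max_right _ _)
  have hc₀m : 4 * 10 ^ 7 * m * (M₀ : ℝ) ^ 2 * C₁' ≤ c₀ :=
    le_trans (le_max_left _ _) (le_trans (le_max_right _ _) (le_max_right _ _))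
  refine ⟨c₀, hc₀pos, fun κ hκ D₀ => ?_⟩
  have hκpos : 0 < κ := lt_of_lt_of_le hc₀pos hκ
  -- `κ' = κ / (2 C₁')`
  set κ' : ℝ := κ / (2 * C₁') with hκ'
  have hκ'pos : 0 < κ' := by rw [hκ']; positivity
  have hκ'7 : (10 : ℝ) ^ 7 ≤ κ' := by
    rw [hκ', le_div_iff₀ (by positivity)]
    nlinarith [hκ, hc₀κ, hC₁'pos]
  -- thresholds on the degree
  set T₁ : ℝ := 10 ^ 7 * max 0 (-Real.log ε₀) / κ' + 1 with hT₁
  set T₂ : ℝ := 2 * 10 ^ 7 * m * max 0 (Real.log E) / κ' + 1 with hT₂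
  set T₃ : ℝ := c₀ * (∑ i, max 0 (Real.log (2 / δ i))) / κ + 1 with hT₃
  have hT₁0 : 0 ≤ T₁ := by rw [hT₁]; positivity
  have hT₂0 : 0 ≤ T₂ := by rw [hT₂]; positivity
  have hT₃0 : 0 ≤ T₃ := by
    rw [hT₃]
    have : 0 ≤ ∑ i, max 0 (Real.log (2 / δ i)) := sum_nonneg fun i _ => le_max_left _ _
    positivity
  set N : ℕ := max D₀ (⌈T₁⌉₊ + ⌈T₂⌉₊ + ⌈T₃⌉₊ + 1) with hN
  /- ## Théorème 3.2: the approximation `α` of `θ` -/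
  obtain ⟨P, hPirr, hdN, hM, α, hαroot, hclose⟩ := thm_3_2 (θ : ℂ) hθℂ κ' hκ'7 N
  set d : ℕ := P.natDegree with hd
  have hNd : N ≤ d := hdN
  have hD₀N : D₀ ≤ N := le_max_left _ _
  have hd1 : 1 ≤ d := le_trans (by rw [hN]; omega) hNd
  have hdT₁ : T₁ ≤ d := by
    have h1 : (⌈T₁⌉₊ : ℝ) ≤ d := by exact_mod_cast le_trans (by rw [hN]; omega) hNd
    exact (Nat.le_ceil T₁).trans h1
  have hdT₂ : T₂ ≤ d := by
    have h1 : (⌈T₂⌉₊ : ℝ) ≤ d := by exact_mod_cast le_trans (by rw [hN]; omega) hNd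
    exact (Nat.le_ceil T₂).trans h1
  have hdT₃ : T₃ ≤ d := by
    have h1 : (⌈T₃⌉₊ : ℝ) ≤ d := by exact_mod_cast le_trans (by rw [hN]; omega) hNd
    exact (Nat.le_ceil T₃).trans h1
  have hdR : (1 : ℝ) ≤ d := by exact_mod_cast hd1
  have hP0 : P ≠ 0 := hPirr.ne_zero
  have hαP : aeval α P = 0 := by
    have h := (mem_roots ((Polynomial.map_ne_zero_iff (Int.castRingHom ℂ).injective_int).mpr hP0)).mp hαroot
    rw [IsRoot, eval_map] at h
    exact h
  obtain ⟨hαint, hαdeg⟩ := natDegree_minpoly_of_irreducible P hPirr (by omega) hαP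
  -- `ε = |α - θ|`
  have hεd : ‖α - (θ : ℂ)‖ ≤ Real.exp (-(κ' * (d : ℝ) ^ 2 / 10 ^ 7)) := by rw [norm_sub_rev]; exact hclose
  have hεd0 : 0 ≤ ‖α - (θ : ℂ)‖ := norm_nonneg _
  -- `(T₁)`: `ε ≤ ε₀`
  have hε₀' : ‖α - (θ : ℂ)‖ ≤ ε₀ := by
    refine hεd.trans ?_
    rw [← Real.exp_log hε₀]
    apply Real.exp_le_exp.mpr
    -- `κ' d² / 10⁷ ≥ -log ε₀`
    have h1 : 10 ^ 7 * max 0 (-Real.log ε₀) / κ' ≤ d := by linarith [hdT₁]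
    rw [div_le_iff₀ hκ'pos] at h1
    have h2 : (d : ℝ) ≤ (d : ℝ) ^ 2 := by nlinarith
    have h3 : max 0 (-Real.log ε₀) * 10 ^ 7 ≤ κ' * (d : ℝ) ^ 2 := by nlinarith [le_max_left 0 (-Real.log ε₀)]
    have h4 := le_max_right 0 (-Real.log ε₀)
    have h5 : -(κ' * (d : ℝ) ^ 2 / 10 ^ 7) ≤ -max 0 (-Real.log ε₀) := by
      rw [neg_le_neg_iff, le_div_iff₀ (by norm_num)]
      linarith
    linarith
  /- ## the root `β̃` and the place -/
  obtain ⟨βt, hβteval, hβt1, hQα0, hdist⟩ := happrox α hε₀'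
  -- `β̃` is integral over `ℚ`: a root of the monic `M_α ∈ ℚ(α)[Y]`
  have hβtint : IsIntegral ℚ βt := by
    set F₁ : IntermediateField ℚ ℂ := IntermediateField.adjoin ℚ {α} with hF₁
    haveI : FiniteDimensional ℚ F₁ := IntermediateField.adjoin.finiteDimensional hαint
    have hαF₁ : α ∈ F₁ := IntermediateField.mem_adjoin_simple_self ℚ α
    set Pβ : F₁[X] := Mq.map (Polynomial.aeval (⟨α, hαF₁⟩ : F₁) : ℚ[X] →ₐ[ℚ] F₁).toRingHom with hPβ
    have hPβmonic : Pβ.Monic := hMqmonic.map _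
    have hPβroot : aeval βt Pβ = 0 := by
      rw [hPβ, aeval_def, eval₂_map]
      have hcomp : (algebraMap F₁ ℂ).comp (Polynomial.aeval (⟨α, hαF₁⟩ : F₁) : ℚ[X] →ₐ[ℚ] F₁).toRingHom =
          (Polynomial.aeval α : ℚ[X] →ₐ[ℚ] ℂ).toRingHom := by
        apply Polynomial.ringHom_ext
        · intro q; simp
        · simp only [RingHom.comp_apply, AlgHom.toRingHom_eq_coe, AlgHom.coe_toRingHom, aeval_X]; rfl
      rw [hcomp]
      exact hβteval
    have h1 : IsIntegral F₁ βt := ⟨Pβ, hPβmonic, by rwa [← aeval_def]⟩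
    exact isIntegral_trans βt h1
  obtain ⟨p, τ, Kt, hred, hKt, hfd, hdegKt, ⟨hθr, hτθ⟩, ⟨hβr, hτβ⟩, hdD, hDd⟩ :=
    exists_place_of_specialization θ hθ β hβint hαint hβtint (by rw [← hMqdef]; exact hβteval)
  haveI := hfd
  haveI : NumberField Kt := numberField_of_intermediateField Kt
  rw [hαdeg] at hdD hDd
  set D : ℕ := p.deg with hDdef
  have hDpos : 0 < D := by omega
  have hDR : (d : ℝ) ≤ D := by exact_mod_cast hdD
  have hDM₀ : (D : ℝ) ≤ M₀ * d := by exact_mod_cast hDd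
  /- ## the coordinates in `𝒪_𝔭` and their reductions -/
  -- numerators
  have hG := fun i => p.hom_doubleSum τ hθr hβr (s i) (c i)
  choose hGmem hτG using hG
  -- denominators
  have hQd := fun i => p.hom_doubleSum τ hθr hβr (range ((Q i).natDegree + 1) ×ˢ range 1) (fun pr => (Q i).coeff pr.1)
  choose hQmem' hτQ' using hQd
  have hQK : ∀ i, aeval θ (Q i) = ∑ pr ∈ range ((Q i).natDegree + 1) ×ˢ range 1,
      (((Q i).coeff pr.1 : ℚ) : K) * θ ^ pr.1 * β ^ pr.2 := by
    intro i; rw [aeval_eq_doubleSum (Q i) θ β]; simp only [eq_ratCast]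
  have hQC : ∀ i, aeval α (Q i) = ∑ pr ∈ range ((Q i).natDegree + 1) ×ˢ range 1,
      (((Q i).coeff pr.1 : ℚ) : ℂ) * α ^ pr.1 * βt ^ pr.2 := by
    intro i; rw [aeval_eq_doubleSum (Q i) α βt]; simp only [eq_ratCast]
  have hQmem : ∀ i, aeval θ (Q i) ∈ p.ring := fun i => by rw [hQK]; exact hQmem' i
  have hτQ : ∀ i, τ ⟨aeval θ (Q i), hQmem i⟩ = aeval α (Q i) := by
    intro i
    have e : (⟨aeval θ (Q i), hQmem i⟩ : p.ring) = ⟨_, hQmem' i⟩ := Subtype.ext (hQK i)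
    rw [e, hτQ' i, hQC i, hτθ, hτβ]
  have hτG' : ∀ i, τ ⟨_, hGmem i⟩ = ∑ pr ∈ s i, ((c i pr : ℚ) : ℂ) * α ^ pr.1 * βt ^ pr.2 := by
    intro i; rw [hτG i, hτθ, hτβ]
  -- the denominators are units of `𝒪_𝔭`
  have hQθ0 : ∀ i, aeval θ (Q i) ≠ 0 := hQ0
  have hQinv : ∀ i, (aeval θ (Q i))⁻¹ ∈ p.ring := by
    intro i
    have hnot : (⟨aeval θ (Q i), hQmem i⟩ : p.ring) ∉ IsLocalRing.maximalIdeal p.ring := by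
      intro hmax
      have hker : (⟨aeval θ (Q i), hQmem i⟩ : p.ring) ∈ RingHom.ker τ := by
        rw [show RingHom.ker τ = IsLocalRing.maximalIdeal p.ring from hred]; exact hmax
      rw [RingHom.mem_ker, hτQ] at hker
      exact hQα0 i hker
    rw [ValuationSubring.mk_mem_maximalIdeal_iff p.ring (hQmem i) (hQθ0 i), not_not] at hnot
    exact hnot
  -- `aᵢ = Gᵢ(θ,β) · Qᵢ(θ)⁻¹ ∈ 𝒪_𝔭`
  have haeq : ∀ i, a i = (∑ pr ∈ s i, ((c i pr : ℚ) : K) * θ ^ pr.1 * β ^ pr.2) * (aeval θ (Q i))⁻¹ := by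
    intro i; rw [← hrepr i, mul_inv_cancel_right₀ (hQθ0 i)]
  have ha : ∀ i, a i ∈ p.ring := fun i => by rw [haeq i]; exact mul_mem (hGmem i) (hQinv i)
  have hτinv : ∀ i, τ ⟨(aeval θ (Q i))⁻¹, hQinv i⟩ = (aeval α (Q i))⁻¹ := by
    intro i
    have h1 : (⟨(aeval θ (Q i))⁻¹, hQinv i⟩ : p.ring) * ⟨aeval θ (Q i), hQmem i⟩ = 1 :=
      Subtype.ext (inv_mul_cancel₀ (hQθ0 i))
    have h2 := congrArg τ h1
    rw [map_mul, map_one, hτQ] at h2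
    exact eq_inv_of_mul_eq_one_left h2
  have hτa : ∀ i, τ ⟨a i, ha i⟩ =
      (∑ pr ∈ s i, ((c i pr : ℚ) : ℂ) * α ^ pr.1 * βt ^ pr.2) / aeval α (Q i) := by
    intro i
    have e : (⟨a i, ha i⟩ : p.ring) = ⟨_, hGmem i⟩ * ⟨(aeval θ (Q i))⁻¹, hQinv i⟩ := Subtype.ext (haeq i)
    rw [e, map_mul, hτG', hτinv, div_eq_mul_inv]
  have hacoe : ∀ i, (a i : ℂ) =
      (∑ pr ∈ s i, ((c i pr : ℚ) : ℂ) * (θ : ℂ) ^ pr.1 * (β : ℂ) ^ pr.2) / aeval (θ : ℂ) (Q i) := by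
    intro i
    rw [eq_div_iff (by rw [← coe_aeval]; exact_mod_cast hQθ0 i), ← coe_aeval, ← coe_doubleSum]
    exact_mod_cast congrArg (fun z : K => (z : ℂ)) (hrepr i)
  /- ## the approximation bound `E ε^{1/m} ≤ exp(-κ D²/c)` -/
  have hmR : (0 : ℝ) < m := by exact_mod_cast hm
  have hexpD : E * ‖α - (θ : ℂ)‖ ^ (1 / (m : ℝ)) ≤ Real.exp (-(κ * (D : ℝ) ^ 2 / c₀)) := by
    -- `ε^{1/m} ≤ exp(-κ' d²/(10⁷ m))`
    have h1 : ‖α - (θ : ℂ)‖ ^ (1 / (m : ℝ)) ≤ Real.exp (-(κ' * (d : ℝ) ^ 2 / 10 ^ 7) * (1 / (m : ℝ))) := by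
      rw [Real.exp_mul]
      exact Real.rpow_le_rpow hεd0 hεd (by positivity)
    -- `E ≤ exp(max 0 (log E))`
    have h2 : E ≤ Real.exp (max 0 (Real.log E)) := by
      rcases hE0.lt_or_eq with hpos | hzero
      · calc E = Real.exp (Real.log E) := (Real.exp_log hpos).symm
          _ ≤ Real.exp (max 0 (Real.log E)) := Real.exp_le_exp.mpr (le_max_right _ _)
      · rw [← hzero]; exact (Real.exp_pos _).le
    -- `(T₂)`: `max 0 (log E) ≤ κ' d² / (2 · 10⁷ m)`
    have h3 : max 0 (Real.log E) ≤ κ' * (d : ℝ) ^ 2 / (2 * 10 ^ 7 * m) := by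
      have h4 : 2 * 10 ^ 7 * m * max 0 (Real.log E) / κ' ≤ d := by linarith [hdT₂]
      rw [div_le_iff₀ hκ'pos] at h4
      rw [le_div_iff₀ (by positivity)]
      have h5 : (d : ℝ) ≤ (d : ℝ) ^ 2 := by nlinarith
      have h6 : 0 ≤ max 0 (Real.log E) := le_max_left _ _
      nlinarith [h4, h5, h6, hκ'pos.le, hmR.le]
    -- `κ D²/c₀ ≤ κ' d²/(2 · 10⁷ m)`
    have h7 : κ * (D : ℝ) ^ 2 / c₀ ≤ κ' * (d : ℝ) ^ 2 / (2 * 10 ^ 7 * m) := by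
      rw [div_le_div_iff₀ hc₀pos (by positivity)]
      have h8 : (D : ℝ) ^ 2 ≤ (M₀ : ℝ) ^ 2 * (d : ℝ) ^ 2 := by
        rw [← mul_pow]; exact pow_le_pow_left₀ (Nat.cast_nonneg _) hDM₀ 2
      have h9 : κ * (2 * 10 ^ 7 * m) * ((M₀ : ℝ) ^ 2 * (d : ℝ) ^ 2) ≤ κ' * (d : ℝ) ^ 2 * c₀ := by
        -- `κ = 2 C₁' κ'` and `c₀ ≥ 4 · 10⁷ m M₀² C₁'`
        have hκeq : κ = 2 * C₁' * κ' := by rw [hκ']; field_simp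
        rw [hκeq]
        have h10 : 0 ≤ κ' * (d : ℝ) ^ 2 := by positivity
        nlinarith [hc₀m, h10, hC₁'pos.le, hmR.le]
      calc κ * (D : ℝ) ^ 2 * (2 * 10 ^ 7 * m) = κ * (2 * 10 ^ 7 * m) * (D : ℝ) ^ 2 := by ring
        _ ≤ κ * (2 * 10 ^ 7 * m) * ((M₀ : ℝ) ^ 2 * (d : ℝ) ^ 2) :=
            mul_le_mul_of_nonneg_left h8 (by positivity)
        _ ≤ κ' * (d : ℝ) ^ 2 * c₀ := h9
    calc E * ‖α - (θ : ℂ)‖ ^ (1 / (m : ℝ))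
        ≤ Real.exp (max 0 (Real.log E)) * Real.exp (-(κ' * (d : ℝ) ^ 2 / 10 ^ 7) * (1 / (m : ℝ))) :=
          mul_le_mul h2 h1 (Real.rpow_nonneg hεd0 _) (Real.exp_pos _).le
      _ = Real.exp (max 0 (Real.log E) + -(κ' * (d : ℝ) ^ 2 / 10 ^ 7) * (1 / (m : ℝ))) := (Real.exp_add _ _).symm
      _ ≤ Real.exp (-(κ * (D : ℝ) ^ 2 / c₀)) := by
          apply Real.exp_le_exp.mpr
          have e : -(κ' * (d : ℝ) ^ 2 / 10 ^ 7) * (1 / (m : ℝ)) = -(2 * (κ' * (d : ℝ) ^ 2 / (2 * 10 ^ 7 * m))) := by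
            field_simp
          rw [e]
          linarith
  have happroxi : ∀ i, ‖(a i : ℂ) - τ ⟨a i, ha i⟩‖ ≤ Real.exp (-(κ * (D : ℝ) ^ 2 / c₀)) := by
    intro i
    rw [hacoe, hτa]
    exact (hdist i).trans hexpD
  /- ## the heights -/
  have hαKt : α ∈ Kt := by have h := hKt ⟨θ, hθr⟩; rwa [hτθ] at h
  have hβKt : βt ∈ Kt := by have h := hKt ⟨β, hβr⟩; rwa [hτβ] at h
  set αK : Kt := ⟨α, hαKt⟩ with hαK
  set βK : Kt := ⟨βt, hβKt⟩ with hβK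
  have hrelKt : (∑ pr ∈ range (DXM + 1) ×ˢ range (m + 1), (cM pr : Kt) * αK ^ pr.1 * βK ^ pr.2) = 0 := by
    have h1 : ((∑ pr ∈ range (DXM + 1) ×ˢ range (m + 1), (cM pr : Kt) * αK ^ pr.1 * βK ^ pr.2 : Kt) : ℂ) =
        ∑ pr ∈ range (DXM + 1) ×ˢ range (m + 1), ((cM pr : ℚ) : ℂ) * α ^ pr.1 * βt ^ pr.2 := by
      push_cast; rfl
    rw [← hMqsumC, hβteval] at h1
    exact_mod_cast h1
  have hh := hheight Kt αK βK hrelKt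
  rw [hdegKt] at hh
  -- `h(α) ≤ κ'`
  have hDRpos : (0 : ℝ) < D := by exact_mod_cast hDpos
  have hαh : logHeight₁ αK ≤ D * κ' := by
    have h1 := MahlerWeil.weilHeight₁_root_le P hPirr (by omega) hαP Kt hαKt
    have h2 : Real.log (P.map (Int.castRingHom ℂ)).mahlerMeasure / P.natDegree ≤ κ' := by
      rw [div_le_iff₀ (by exact_mod_cast (show 0 < P.natDegree by omega))]
      exact hM
    have h3 := weilHeight₁_single_eq Kt hαKt
    rw [hdegKt] at h3
    rw [h3, div_le_iff₀ hDRpos] at h1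
    calc logHeight₁ αK ≤ Real.log (P.map (Int.castRingHom ℂ)).mahlerMeasure / P.natDegree * D := h1
      _ ≤ κ' * D := mul_le_mul_of_nonneg_right h2 hDRpos.le
      _ = D * κ' := mul_comm _ _
  -- the reduced coordinates as elements of `K̃`
  set aK : ι → Kt := fun i => (∑ pr ∈ s i, (c i pr : Kt) * αK ^ pr.1 * βK ^ pr.2) / aeval αK (Q i) with haK
  have haKcoe : ∀ i, ((aK i : Kt) : ℂ) = τ ⟨a i, ha i⟩ := by
    intro i
    rw [hτa, haK]
    push_cast
    rw [coe_aeval]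
  have hheightle : weilHeight₁ Kt (fun i => τ ⟨a i, ha i⟩) ≤ κ := by
    have e : (fun i => τ ⟨a i, ha i⟩) = fun i => ((aK i : Kt) : ℂ) := funext fun i => (haKcoe i).symm
    rw [e]
    refine (weilHeight₁_le_sum_single Kt _ fun i => (aK i).2).trans ?_
    have h1 : ∀ i, weilHeight₁ Kt (fun _ : Unit => ((aK i : Kt) : ℂ)) = logHeight₁ (aK i) / D := by
      intro i
      rw [weilHeight₁_single_eq Kt (aK i).2, hdegKt]
    rw [Finset.sum_congr rfl fun i _ => h1 i, ← Finset.sum_div, div_le_iff₀ hDRpos]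
    have h2 : C₂ ≤ κ / 2 := by linarith [hc₀C₂, hκ]
    have h3 : C₁ * (D * κ') ≤ D * (κ / 2) := by
      have h4 : C₁ * κ' ≤ κ / 2 := by
        rw [hκ']
        rw [show C₁ * (κ / (2 * C₁')) = (C₁ / C₁') * (κ / 2) by field_simp]
        exact mul_le_of_le_one_left (by positivity) ((div_le_one hC₁'pos).mpr (by rw [hC₁']; linarith))
      nlinarith [h4, hDRpos.le]
    have h5 : C₁ * logHeight₁ αK ≤ C₁ * (D * κ') := mul_le_mul_of_nonneg_left hαh hC₁
    calc ∑ i, logHeight₁ (aK i) ≤ D * C₂ + C₁ * logHeight₁ αK := hh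
      _ ≤ D * (κ / 2) + D * (κ / 2) := by nlinarith [h2, h3, h5, hDRpos.le]
      _ = κ * D := by ring
  /- ## algebraic coordinates are unchanged -/
  have halg : ∀ i, IsAlgebraic ℚ (a i : ℂ) → τ ⟨a i, ha i⟩ = a i := by
    intro i hai
    set μ : ℚ[X] := minpoly ℚ (a i : ℂ) with hμ
    -- `τ(aᵢ)` is a root of `μ`
    obtain ⟨hmem, hτμ⟩ := p.hom_doubleSum τ (ha i) (ha i) (range (μ.natDegree + 1) ×ˢ range 1) (fun pr => μ.coeff pr.1)
    have hK0 : (∑ pr ∈ range (μ.natDegree + 1) ×ˢ range 1, ((μ.coeff pr.1 : ℚ) : K) * a i ^ pr.1 * a i ^ pr.2) = 0 := by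
      have h1 : aeval (a i) μ = ∑ pr ∈ range (μ.natDegree + 1) ×ˢ range 1,
          ((μ.coeff pr.1 : ℚ) : K) * a i ^ pr.1 * a i ^ pr.2 := by
        rw [aeval_eq_doubleSum μ (a i) (a i)]; simp only [eq_ratCast]
      rw [← h1]
      have h2 : ((aeval (a i) μ : K) : ℂ) = 0 := by rw [coe_aeval, hμ, minpoly.aeval]
      exact_mod_cast h2
    have hroot : aeval (τ ⟨a i, ha i⟩) μ = 0 := by
      rw [aeval_eq_doubleSum μ (τ ⟨a i, ha i⟩) (τ ⟨a i, ha i⟩)]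
      simp only [eq_ratCast]
      rw [← hτμ]
      have e : (⟨_, hmem⟩ : p.ring) = 0 := Subtype.ext hK0
      rw [e, map_zero]
    by_contra hne
    have h1 := hδ i hai (τ ⟨a i, ha i⟩) hroot hne
    have h2 := happroxi i
    rw [norm_sub_rev] at h1
    -- `(T₃)`: `exp(-κ D²/c₀) < δ i`
    have h3 : Real.exp (-(κ * (D : ℝ) ^ 2 / c₀)) < δ i := by
      have h4 : c₀ * (∑ j, max 0 (Real.log (2 / δ j))) / κ ≤ d := by linarith [hdT₃]
      rw [div_le_iff₀ hκpos] at h4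
      have h5 : max 0 (Real.log (2 / δ i)) ≤ ∑ j, max 0 (Real.log (2 / δ j)) :=
        Finset.single_le_sum (f := fun j => max 0 (Real.log (2 / δ j))) (fun j _ => le_max_left _ _) (mem_univ i)
      have h6 : Real.log (2 / δ i) ≤ κ * (D : ℝ) ^ 2 / c₀ := by
        rw [le_div_iff₀ hc₀pos]
        have h7 : (d : ℝ) ≤ (D : ℝ) ^ 2 := by nlinarith [hDR, hdR]
        have h8 : 0 ≤ max 0 (Real.log (2 / δ i)) := le_max_left _ _
        nlinarith [le_max_right 0 (Real.log (2 / δ i)), h4, h5, h7, h8, hκpos.le, hc₀pos.le]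
      calc Real.exp (-(κ * (D : ℝ) ^ 2 / c₀)) ≤ Real.exp (-Real.log (2 / δ i)) := Real.exp_le_exp.mpr (by linarith)
        _ = δ i / 2 := by rw [Real.exp_neg, Real.exp_log (by have := hδ0 i; positivity)]; field_simp
        _ < δ i := by linarith [hδ0 i]
    linarith
  exact ⟨D, hD₀N.trans (hNd.trans hdD), p, τ, Kt, hred, rfl, hKt, hfd, hdegKt, ha, hheightle, happroxi, halg⟩

end RoyWaldschmidt1997

end Literature.NumberTheory.Transcendental
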